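import Literature.AlgebraicTopology.Homotopy.CubeHomotopyExtension
import Literature.AlgebraicTopology.Homotopy.StrongDeformationRetractTransport
import Literature.AlgebraicTopology.Homotopy.StrongDeformationRetractUnion
import Literature.AlgebraicTopology.FundamentalGroup.DeformationRetractInclusion
import Literature.AlgebraicTopology.Homotopy.StrongDeformationRetractSqueeze
import Mathlib.Analysis.Convex.Contractible
import Mathlib.Analysis.InnerProductSpace.PiL2
import Mathlib.AlgebraicTopology.FundamentalGroupoid.SimplyConnected
import Mathlib.Topology.OpenPartialHomeomorph.Basic
import HarnessLib

/-!
# Biting a half-cylinder out of a handlebody along the central surface does not change `π₁`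

Topic `Literature/Topology/FourManifolds`; fact seat
`provefact-Literature.Topology.FourManifolds.sphere-99d675ea90` (named fact (d′)
`Literature.Topology.FourManifolds.sphere_gkTrisections`).  Everything in this file is **proved**;
there are no definitions and no named facts.

The `π₁` stage of a Gay–Kirby stabilisation
(`Literature.Topology.FourManifolds.exists_marking_groupGKTrisectionOf_eq_stabilize`,
`…_datum`) presents each new handlebody as `H′ᵢ = A^H ∪_E B^H`, where `A^H` is the part of the OLD
handlebody `Hᵢ = S(i+1) ∩ S(i+2)` outside the region of modification, and asks (hypothesis `hjA`)
that `π₁(A^H, x₀) → π₁(Hᵢ, x₀)` be injective.  When the modification is confined to a box of a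
joint chart `Θ` at a point of the central surface `F` (`IsGKTrisection.exists_jointChart`: the
three sectors are linear sectors of the normal `(q₀, q₁)`-plane, `F = {q₀ = q₁ = 0}`, and each
handlebody is a closed half-plane `{(q₀, q₁) = s v, s ≥ 0} × ℝ²`), the natural `A^H` is `Hᵢ`
minus the **bite** `U = {s < δ, ‖(q₂, q₃)‖ < ρ}` — an open half-cylinder `[0, δ) × B²(ρ)` of
the half-plane bundle sitting on `F`.  This file proves that `Hᵢ ∖ U` is a strong deformation
retract of `Hᵢ`, so that `π₁(Hᵢ ∖ U) → π₁(Hᵢ)` is bijective (Hatcher, Prop. 1.17), for every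
handlebody of every joint chart:

* `isStrongDeformationRetractOf_cup_box` — **the solid cylinder retracts onto its cup**: in
  `E × ℝ` (`E` a real normed space) `D × {0} ∪ ∂D × [0, τ]` is a strong deformation retract of
  `D × [0, τ]` (`D` the closed unit ball, `0 < τ ≤ 1`), by the straight-line homotopy to
  Hatcher's radial projection from `(0, 2τ)` (Prop. 0.16, the tree's `CubeHEP.fill`);
* `isStrongDeformationRetractOf_diff_of_bite` — **absorbing a bite**: if `C ⊆ H` are closed,
  `C` strong deformation retracts onto `F`, and `U` is open with `H ∩ U = C ∖ F`, then `H ∖ U`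
  is a strong deformation retract of `H` (paste the deformation of `C` with the identity of
  `H ∖ U`, `IsStrongDeformationRetractOf.union_of_inter_subset`), and
  `bijective_inclHomOfSubset_diff_of_bite` (`π₁(H ∖ U) ≅ π₁(H)`);
* `isStrongDeformationRetractOf_diff_chartBite`, `bijective_inclHomOfSubset_diff_chartBite` —
  **the chart bite**: for a local homeomorphism `Θ` onto an open subset of `ℝ⁴`, a closed `H`
  with `H ∩ Θ.source = {(q₀, q₁) ∈ ℝ₊ v}` (`v ≠ 0`) and `δ, ρ > 0` with the closed half-cylinder
  `{s v : 0 ≤ s ≤ δ} × B̄²(ρ)` inside `Θ.target`, the bite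
  `U = {y ∈ Θ.source | ⟪(Θ y)₀₁, v⟫ < δ ‖v‖², ‖(Θ y)₂₃‖ < ρ}` satisfies: `H ∖ U` is a strong
  deformation retract of `H`, and `π₁(H ∖ U, x₀) → π₁(H, x₀)` is bijective for `x₀ ∈ H ∖ U`;
* `isStrongDeformationRetractOf_bottom_cup`, `isSimplyConnected_cup`,
  `isStrongDeformationRetractOf_cup_shell` — the cup is a disc (retracts onto its convex bottom),
  and the shell `{-ε < t ≤ 1, ‖w‖ < 1 + ε', t ≤ 0 ∨ 1 ≤ ‖w‖}` around the cylinder retracts onto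
  the cup (nearest-point projection onto the convex cylinder);
* `isSimplyConnected_chartCup`, `isStrongDeformationRetractOf_chartCup_shell` — **the chart cup
  `E` = closed half-cylinder ∖ bite is simply connected, and `(H ∖ U) ∩ U′` (trace of a slightly
  larger open bite `U′`) is a collar of `E` in `H ∖ U` strong deformation retracting onto it** —
  hypotheses `hE1`, `hEpc`, `hOAH`, `hCAHe`, `hECAH`, `hsdrA` of the stabilisation step for
  `A^H = H ∖ U`, `E = A^H ∩ (closed half-cylinder)`, `O_{A^H} = U′`;
* `bijective_inclHomOfSubset_diff_jointChartBite_ij` / `_il` / `_jl` — the three handlebodies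
  `S i ∩ S j = {q₀ = 0 ≤ q₁}`, `S i ∩ S l = {q₁ = 0 ≤ q₀}`, `S j ∩ S l = {q₀ = q₁ ≤ 0}` of a joint
  chart (`v = (0,1), (1,0), (-1,-1)`), i.e. hypothesis `hjA` of the stabilisation step for a
  modification supported in the chart box, at every genus.

## References

* A. Hatcher, *Algebraic Topology*, CUP (2002): Prop. 0.16 (`Dⁿ × I` retracts onto
  `Dⁿ × {0} ∪ ∂Dⁿ × I`), Ch. 0 p. 2, Prop. 1.17 (deformation retractions induce isomorphisms on
  `π₁`). [HatcherAT2002]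
* D. Gay, R. Kirby, *Trisecting 4-manifolds*, Geom. Topol. 20 (2016) 3097–3132: Def. 1 and
  Fig. 1 (the sectors near `F`), Def. 8 (stabilisation along arcs in the `Hᵢⱼ` near `F`).
  [GayKirby2016]
-/

noncomputable section

open Set Metric Function
open Literature.AlgebraicTopology.FundamentalGroup
open Literature.AlgebraicTopology.FundamentalGroup.VanKampen
open Literature.AlgebraicTopology.Homotopy
open scoped unitInterval Topology

namespace Literature.Topology.FourManifolds

universe u

/-! ### The solid cylinder retracts onto its cup -/

section CupBox

variable {E : Type*} [NormedAddCommGroup E] [NormedSpace ℝ E]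

/-- Hatcher's radial projection of the solid cylinder `D × [0, τ]` from the apex `(0, 2τ)`, as a
self-map of `E × ℝ` (the tree's `CubeHEP.fill` with `φ w = (w, 0)` and `h = id`), lands in the
cup `D × {0} ∪ ∂D × [0, τ]`. [cite: HatcherAT2002, Prop. 0.16] -/
theorem fill_mem_cup {τ : ℝ} (hτ : 0 < τ) {p : E × ℝ}
    (hp : p ∈ closedBall (0 : E) 1 ×ˢ Icc (0 : ℝ) τ) :
    CubeHEP.fill τ (fun w => ((w, 0) : E × ℝ)) (fun p => p) p ∈
      closedBall (0 : E) 1 ×ˢ ({0} : Set ℝ) ∪ sphere (0 : E) 1 ×ˢ Icc (0 : ℝ) τ := by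
  obtain ⟨w, t⟩ := p
  obtain ⟨hw, ht⟩ := hp
  have hw1 : ‖w‖ ≤ 1 := mem_closedBall_zero_iff.mp hw
  have hpos : 0 < 2 * τ - t := by linarith [ht.2]
  unfold CubeHEP.fill
  split_ifs with hc
  · refine Or.inl ⟨?_, rfl⟩
    rw [mem_closedBall_zero_iff, norm_smul, Real.norm_of_nonneg (by positivity)]
    rw [div_mul_eq_mul_div, div_le_one hpos]
    exact hc
  · rw [not_le] at hc
    have hn : 0 < ‖w‖ := by
      by_contra h
      have h0 : ‖w‖ = 0 := le_antisymm (not_lt.mp h) (norm_nonneg _)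
      rw [h0, mul_zero] at hc
      linarith
    refine Or.inr ⟨?_, ?_, ?_⟩
    · rw [mem_sphere_zero_iff_norm, norm_smul, norm_inv, norm_norm, inv_mul_cancel₀ hn.ne']
    · -- `0 ≤ 2τ - (2τ - t)/‖w‖` from `2τ‖w‖ > 2τ - t`
      have : (2 * τ - t) / ‖w‖ < 2 * τ := by
        rw [div_lt_iff₀ hn]
        linarith
      linarith
    · -- `≤ τ` from `‖w‖ ≤ 1`
      have : 2 * τ - t ≤ (2 * τ - t) / ‖w‖ := by
        rw [le_div_iff₀ hn]
        nlinarith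
      linarith [ht.2]

/-- The radial projection fixes the cup pointwise. [cite: HatcherAT2002, Prop. 0.16] -/
theorem fill_eq_self_of_mem_cup {τ : ℝ} (hτ : 0 < τ) {p : E × ℝ}
    (hp : p ∈ closedBall (0 : E) 1 ×ˢ ({0} : Set ℝ) ∪ sphere (0 : E) 1 ×ˢ Icc (0 : ℝ) τ) :
    CubeHEP.fill τ (fun w => ((w, 0) : E × ℝ)) (fun p => p) p = p := by
  obtain ⟨w, t⟩ := p
  rcases hp with ⟨hw, ht⟩ | ⟨hw, ht⟩
  · have ht0 : t = 0 := ht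
    subst ht0
    exact CubeHEP.fill_bottom (φ := fun w => ((w, 0) : E × ℝ)) (h := fun p => p) hτ hw
  · exact CubeHEP.fill_side (φ := fun w => ((w, 0) : E × ℝ)) (h := fun p => p) hτ
      (fun w _ => rfl) hw ht

/-- **The solid cylinder strong deformation retracts onto its cup** (Hatcher, Prop. 0.16:
"`Dⁿ × I` retracts onto `Dⁿ × {0} ∪ ∂Dⁿ × I`", here for the closed unit ball `D` of any real
normed space and height `0 < τ ≤ 1`): the straight-line homotopy from the identity to the radial
projection from `(0, 2τ)` stays in the convex cylinder and fixes the cup. The face `D × {τ}` is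
the free face. [cite: HatcherAT2002, Prop. 0.16 and Ch. 0 p. 2] -/
theorem isStrongDeformationRetractOf_cup_box {τ : ℝ} (hτ : 0 < τ) (hτ1 : τ ≤ 1) :
    IsStrongDeformationRetractOf
      (closedBall (0 : E) 1 ×ˢ ({0} : Set ℝ) ∪ sphere (0 : E) 1 ×ˢ Icc (0 : ℝ) τ)
      (closedBall (0 : E) 1 ×ˢ Icc (0 : ℝ) τ) := by
  set r : E × ℝ → E × ℝ := CubeHEP.fill τ (fun w => ((w, 0) : E × ℝ)) (fun p => p) with hr
  set box : Set (E × ℝ) := closedBall (0 : E) 1 ×ˢ Icc (0 : ℝ) τ with hbox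
  set cup : Set (E × ℝ) :=
    closedBall (0 : E) 1 ×ˢ ({0} : Set ℝ) ∪ sphere (0 : E) 1 ×ˢ Icc (0 : ℝ) τ with hcup
  have hcupbox : cup ⊆ box := by
    rintro ⟨w, t⟩ (⟨hw, ht⟩ | ⟨hw, ht⟩)
    · have ht0 : t = 0 := ht
      exact ⟨hw, by rw [ht0]; exact ⟨le_rfl, hτ.le⟩⟩
    · exact ⟨sphere_subset_closedBall hw, ht⟩
  have hrc : ContinuousOn r box :=
    CubeHEP.fill_continuousOn hτ hτ1 (continuous_id.prodMk continuous_const).continuousOn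
      continuousOn_id (fun w _ => rfl)
  have hrmem : ∀ p ∈ box, r p ∈ cup := fun p hp => fill_mem_cup hτ hp
  have hrfix : ∀ p ∈ cup, r p = p := fun p hp => fill_eq_self_of_mem_cup hτ hp
  have hconv : Convex ℝ box := (convex_closedBall 0 1).prod (convex_Icc 0 τ)
  refine IsStrongDeformationRetractOf.of_continuousOn (fun s p => (1 - s) • p + s • r p)
    ?_ ?_ ?_ ?_ ?_
  · exact (((continuous_const.sub continuous_fst).continuousOn.smul continuousOn_snd)).add
      (continuous_fst.continuousOn.smul (hrc.comp continuousOn_snd fun q hq => hq.2))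
  · intro s hs p hp
    exact hconv hp (hcupbox (hrmem p hp)) (by linarith [hs.2]) hs.1 (by ring)
  · intro p _
    simp
  · intro p hp
    simpa using hrmem p hp
  · intro s _ p _ hp
    rw [hrfix p hp, sub_smul, one_smul, sub_add_cancel]

end CupBox


/-! ### The cup is a disc: simply connected; the shell around the cylinder retracts onto it -/

section CupDisc

variable {E : Type*} [NormedAddCommGroup E] [NormedSpace ℝ E]

omit [NormedSpace ℝ E] in
/-- **The cup retracts onto its bottom**: `D × {0}` is a strong deformation retract of
`D × {0} ∪ ∂D × [0, τ]` (push the sides down, `(w, t) ↦ (w, (1 - c) t)`). [cite: HatcherAT2002, Ch. 0, p. 2] -/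
theorem isStrongDeformationRetractOf_bottom_cup (τ : ℝ) :
    IsStrongDeformationRetractOf (closedBall (0 : E) 1 ×ˢ ({0} : Set ℝ))
      (closedBall (0 : E) 1 ×ˢ ({0} : Set ℝ) ∪ sphere (0 : E) 1 ×ˢ Icc (0 : ℝ) τ) := by
  refine IsStrongDeformationRetractOf.of_continuousOn (fun c p => (p.1, (1 - c) * p.2))
    (by fun_prop) ?_ ?_ ?_ ?_
  · rintro c hc ⟨w, t⟩ (⟨hw, ht⟩ | ⟨hw, ht⟩)
    · have ht0 : t = 0 := ht
      exact Or.inl ⟨hw, by simp [ht0]⟩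
    · refine Or.inr ⟨hw, ?_, ?_⟩
      · exact mul_nonneg (by linarith [hc.2]) ht.1
      · nlinarith [hc.1, hc.2, ht.1, ht.2]
  · rintro ⟨w, t⟩ _
    simp
  · rintro ⟨w, t⟩ (⟨hw, ht⟩ | ⟨hw, ht⟩)
    · exact ⟨hw, by simp⟩
    · exact ⟨sphere_subset_closedBall hw, by simp⟩
  · rintro c _ ⟨w, t⟩ _ ⟨hw, ht⟩
    have ht0 : t = 0 := ht
    simp [ht0]

/-- **The cup is simply connected** (it deformation retracts onto the convex disc `D × {0}`).
[folklore] -/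
theorem isSimplyConnected_cup (τ : ℝ) :
    IsSimplyConnected (closedBall (0 : E) 1 ×ˢ ({0} : Set ℝ) ∪ sphere (0 : E) 1 ×ˢ Icc (0 : ℝ) τ) := by
  have hb : IsSimplyConnected (closedBall (0 : E) 1 ×ˢ ({0} : Set ℝ)) := by
    haveI := ((convex_closedBall (0 : E) 1).prod (convex_singleton (0 : ℝ))).contractibleSpace
      ⟨(0, 0), mem_closedBall_self zero_le_one, rfl⟩
    exact SimplyConnectedSpace.ofContractible _
  obtain ⟨e, -⟩ := (isStrongDeformationRetractOf_bottom_cup (E := E) τ).exists_homotopyEquiv_inclusion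
    subset_union_left
  haveI : SimplyConnectedSpace ↥(closedBall (0 : E) 1 ×ˢ ({0} : Set ℝ)) := hb
  exact e.symm.simplyConnectedSpace

/-- **The shell retracts onto the cup.**  For `ε, ε' > 0` the region
`{(w, t) | -ε < t ≤ 1, ‖w‖ < 1 + ε', t ≤ 0 ∨ 1 ≤ ‖w‖}` of `E × ℝ` — the part, below the free
face `t = 1`, of an open neighbourhood of the solid cylinder `D × [0, 1]` lying outside the open
bite `B(0,1) × (0, 1]` — strong deformation retracts onto the cup `D × {0} ∪ ∂D × [0, 1]`, by the
straight-line homotopy to the nearest-point projection onto the convex cylinder,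
`(w, t) ↦ ((max ‖w‖ 1)⁻¹ w, max t 0)`. [cite: HatcherAT2002, Ch. 0, p. 2] -/
theorem isStrongDeformationRetractOf_cup_shell (ε ε' : ℝ) :
    IsStrongDeformationRetractOf
      (closedBall (0 : E) 1 ×ˢ ({0} : Set ℝ) ∪ sphere (0 : E) 1 ×ˢ Icc (0 : ℝ) 1)
      {p : E × ℝ | -ε < p.2 ∧ p.2 ≤ 1 ∧ ‖p.1‖ < 1 + ε' ∧ (p.2 ≤ 0 ∨ 1 ≤ ‖p.1‖)} := by
  -- the nearest-point projection onto `D × [0, 1]`, coordinatewise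
  have hmax : ∀ w : E, 0 < max ‖w‖ 1 := fun w => lt_of_lt_of_le one_pos (le_max_right _ _)
  have hcont : Continuous fun q : ℝ × (E × ℝ) =>
      (((1 - q.1) + q.1 * (max ‖q.2.1‖ 1)⁻¹) • q.2.1, (1 - q.1) * q.2.2 + q.1 * max q.2.2 0) := by
    refine Continuous.prodMk ?_ (by fun_prop)
    refine Continuous.smul ?_ (by fun_prop)
    refine (continuous_const.sub continuous_fst).add (continuous_fst.mul ?_)
    refine Continuous.inv₀ (by fun_prop) fun q => (hmax q.2.1).ne'
  refine IsStrongDeformationRetractOf.of_continuousOn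
    (fun c p => ((((1 - c) + c * (max ‖p.1‖ 1)⁻¹) • p.1, (1 - c) * p.2 + c * max p.2 0) : E × ℝ))
    hcont.continuousOn ?_ ?_ ?_ ?_
  · -- the shell is preserved
    rintro c ⟨hc0, hc1⟩ ⟨w, t⟩ ⟨ht, ht1, hw, hor⟩
    have hc1 : (max ‖w‖ 1)⁻¹ ≤ 1 := inv_le_one_of_one_le₀ (le_max_right _ _)
    have hc0 : 0 < (max ‖w‖ 1)⁻¹ := inv_pos.mpr (hmax w)
    have hcoef0 : 0 ≤ (1 - c) + c * (max ‖w‖ 1)⁻¹ := by nlinarith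
    have hcoef1 : (1 - c) + c * (max ‖w‖ 1)⁻¹ ≤ 1 := by nlinarith
    have hnorm : ‖(((1 - c) + c * (max ‖w‖ 1)⁻¹) • w : E)‖ = ((1 - c) + c * (max ‖w‖ 1)⁻¹) * ‖w‖ := by
      rw [norm_smul, Real.norm_of_nonneg hcoef0]
    simp only [mem_setOf_eq]
    refine ⟨?_, ?_, ?_, ?_⟩
    · have : 0 ≤ max t 0 := le_max_right _ _
      nlinarith [le_max_left t 0]
    · have : max t 0 ≤ 1 := max_le ht1 zero_le_one
      nlinarith
    · rw [hnorm]
      nlinarith [norm_nonneg w]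
    · rcases hor with h | h
      · left
        rw [max_eq_right h]
        nlinarith
      · right
        rw [hnorm, max_eq_left h, mul_comm, ← div_eq_mul_inv] at *
        -- `((1-c) + c/‖w‖) ‖w‖ = (1-c)‖w‖ + c ≥ 1`
        have hw0 : 0 < ‖w‖ := by linarith
        rw [mul_comm, add_mul, div_mul_cancel₀ c hw0.ne']
        nlinarith
  · rintro ⟨w, t⟩ _
    simp
  · -- ends on the cup
    rintro ⟨w, t⟩ ⟨ht, ht1, hw, hor⟩
    simp only [sub_self, zero_add, one_mul, zero_mul]
    rcases le_or_gt t 0 with h | h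
    · left
      refine ⟨?_, by simp [max_eq_right h]⟩
      rw [mem_closedBall_zero_iff, norm_smul, norm_inv, Real.norm_of_nonneg (hmax w).le]
      rw [inv_mul_le_iff₀ (hmax w), mul_one]
      exact le_max_left _ _
    · have hw1 : 1 ≤ ‖w‖ := by
        rcases hor with h' | h'
        · exact absurd h' (not_le.mpr h)
        · exact h'
      right
      refine ⟨?_, ?_⟩
      · rw [mem_sphere_zero_iff_norm, norm_smul, norm_inv, Real.norm_of_nonneg (hmax w).le,
          max_eq_left hw1, inv_mul_cancel₀ (by linarith)]
      · rw [max_eq_left h.le]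
        exact ⟨h.le, ht1⟩
  · -- fixes the cup
    rintro c _ ⟨w, t⟩ _ (⟨hw, ht⟩ | ⟨hw, ht⟩)
    · have ht0 : t = 0 := ht
      have hw1 : ‖w‖ ≤ 1 := mem_closedBall_zero_iff.mp hw
      simp [ht0, max_eq_right hw1]
    · have hw1 : ‖w‖ = 1 := mem_sphere_zero_iff_norm.mp hw
      refine Prod.ext ?_ ?_
      · simp [hw1]
      · show (1 - c) * t + c * max t 0 = t
        rw [max_eq_left ht.1]
        ring

end CupDisc

/-! ### Absorbing a bite -/

section Bite

variable {X : Type u} [TopologicalSpace X]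

/-- **Absorbing a bite.**  Let `C ⊆ H` be closed subsets of `X` with `C` strong deformation
retracting onto `F`, and `U` an open set with `H ∩ U = C ∖ F` (the bite `C ∖ F` is open in `H`:
`C` sits on the frontier of `H` along its free face).  Then `H ∖ U` is a strong deformation
retract of `H`: the deformation of `C` and the identity of `H ∖ U` agree on `(H ∖ U) ∩ C ⊆ F`
and paste along the two closed pieces. [cite: HatcherAT2002, Ch. 0, p. 2] -/
theorem isStrongDeformationRetractOf_diff_of_bite {H C F U : Set X} (hH : IsClosed H)
    (hC : IsClosed C) (hCH : C ⊆ H) (hsdr : IsStrongDeformationRetractOf F C) (hU : IsOpen U)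
    (hHU : H ∩ U = C \ F) : IsStrongDeformationRetractOf (H \ U) H := by
  have hP : IsClosed (H \ U) := hH.sdiff hU
  have hPC : (H \ U) ∩ C ⊆ F := by
    rintro x ⟨⟨hxH, hxU⟩, hxC⟩
    by_contra hxF
    have : x ∈ H ∩ U := by rw [hHU]; exact ⟨hxC, hxF⟩
    exact hxU this.2
  have hFP : F ∩ C ⊆ H \ U := by
    rintro x ⟨hxF, hxC⟩
    refine ⟨hCH hxC, fun hxU => ?_⟩
    have : x ∈ C \ F := by rw [← hHU]; exact ⟨hCH hxC, hxU⟩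
    exact this.2 hxF
  have h := hsdr.union_of_inter_subset hPC hFP
    (fun x hx => by rw [hP.closure_eq] at hx; exact hx.1)
    (fun x hx => by rw [hC.closure_eq] at hx; exact hx.1)
  have e : (H \ U) ∪ C = H := by
    apply subset_antisymm (union_subset (fun _ hx => hx.1) hCH)
    intro x hxH
    by_cases hxU : x ∈ U
    · have : x ∈ C \ F := by rw [← hHU]; exact ⟨hxH, hxU⟩
      exact Or.inr this.1
    · exact Or.inl ⟨hxH, hxU⟩
  rwa [e] at h

/-- **A bite does not change `π₁`**: under the hypotheses of
`isStrongDeformationRetractOf_diff_of_bite`, `π₁(H ∖ U, x₀) → π₁(H, x₀)` is bijective for every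
`x₀ ∈ H ∖ U` (Hatcher, Prop. 1.17). [cite: HatcherAT2002, Prop. 1.17] -/
theorem bijective_inclHomOfSubset_diff_of_bite {H C F U : Set X} (hH : IsClosed H)
    (hC : IsClosed C) (hCH : C ⊆ H) (hsdr : IsStrongDeformationRetractOf F C) (hU : IsOpen U)
    (hHU : H ∩ U = C \ F) {x₀ : X} (hx₀ : x₀ ∈ H \ U) :
    Bijective (inclHomOfSubset (fun _ hx => hx.1 : H \ U ⊆ H) x₀ hx₀ hx₀.1) :=
  bijective_inclHomOfSubset_of_isStrongDeformationRetractOf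
    (isStrongDeformationRetractOf_diff_of_bite hH hC hCH hsdr hU hHU) _ hx₀

end Bite

/-! ### The chart bite -/

section ChartBite

variable {X : Type u} [TopologicalSpace X] [T2Space X]

/-- **Biting an open half-cylinder out of a half-plane bundle in a chart.**  Let `Θ` be a local
homeomorphism of `X` onto an open subset of `ℝ⁴`, `H ⊆ X` closed with
`H ∩ Θ.source = {y | (Θ y)₀₁ = s v, s ≥ 0}` for a non-zero `v = (v₀, v₁)` (a handlebody of a
joint chart), and `δ, ρ > 0` such that the closed half-cylinder `{s v | 0 ≤ s ≤ δ} × B̄²(ρ)` lies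
in `Θ.target`.  Then `H` minus the bite `U = {y ∈ Θ.source | ⟪(Θ y)₀₁, v⟫ < δ‖v‖², ‖(Θ y)₂₃‖ < ρ}`
is a strong deformation retract of `H`: the closed half-cylinder, parametrised by the solid
cylinder `D × [0, 1]` of `ℝ² × ℝ` through `(w, t) ↦ Θ⁻¹(δ(1 - t) v, ρ w)` (free face `t = 1` on
the central surface `s = 0`), retracts onto its cup (`isStrongDeformationRetractOf_cup_box`), and
the bite is absorbed (`isStrongDeformationRetractOf_diff_of_bite`).
[cite: HatcherAT2002, Prop. 0.16 and Prop. 1.17] [cite: GayKirby2016, Def. 1 and Fig. 1; Def. 8] -/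
theorem isStrongDeformationRetractOf_diff_chartBite
    (Θ : OpenPartialHomeomorph X (EuclideanSpace ℝ (Fin 4))) {H : Set X} (hH : IsClosed H)
    {v₀ v₁ : ℝ} (hv : v₀ ≠ 0 ∨ v₁ ≠ 0)
    (hHΘ : ∀ y ∈ Θ.source, y ∈ H ↔ ∃ s : ℝ, 0 ≤ s ∧ Θ y 0 = s * v₀ ∧ Θ y 1 = s * v₁)
    {δ ρ : ℝ} (hδ : 0 < δ) (hρ : 0 < ρ)
    (htarget : ∀ s ∈ Icc (0 : ℝ) δ, ∀ w : EuclideanSpace ℝ (Fin 2), ‖w‖ ≤ ρ →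
      (!₂[s * v₀, s * v₁, w 0, w 1] : EuclideanSpace ℝ (Fin 4)) ∈ Θ.target) :
    IsStrongDeformationRetractOf
      (H \ {y | y ∈ Θ.source ∧ v₀ * Θ y 0 + v₁ * Θ y 1 < δ * (v₀ ^ 2 + v₁ ^ 2) ∧
        ‖(!₂[Θ y 2, Θ y 3] : EuclideanSpace ℝ (Fin 2))‖ < ρ}) H := by
  have hnv : 0 < v₀ ^ 2 + v₁ ^ 2 := by
    rcases hv with h | h
    · have := sq_pos_of_ne_zero h; positivity
    · have := sq_pos_of_ne_zero h; positivity
  -- the parametrisation `P (w, t) = (δ(1-t) v, ρ w)` of the closed half-cylinder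
  set P : EuclideanSpace ℝ (Fin 2) × ℝ → EuclideanSpace ℝ (Fin 4) :=
    fun p => !₂[δ * (1 - p.2) * v₀, δ * (1 - p.2) * v₁, ρ * p.1 0, ρ * p.1 1] with hP
  have hP0 : ∀ p, P p 0 = δ * (1 - p.2) * v₀ := fun p => by simp [hP]
  have hP1 : ∀ p, P p 1 = δ * (1 - p.2) * v₁ := fun p => by simp [hP]
  have hP2 : ∀ p, P p 2 = ρ * p.1 0 := fun p => by simp [hP]
  have hP3 : ∀ p, P p 3 = ρ * p.1 1 := fun p => by simp [hP]
  have hPc : Continuous P := by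
    have h0 : Continuous fun p : EuclideanSpace ℝ (Fin 2) × ℝ => p.1 0 :=
      (PiLp.continuous_apply 2 _ 0).comp continuous_fst
    have h1 : Continuous fun p : EuclideanSpace ℝ (Fin 2) × ℝ => p.1 1 :=
      (PiLp.continuous_apply 2 _ 1).comp continuous_fst
    refine (PiLp.continuous_toLp 2 (fun _ : Fin 4 => ℝ)).comp ?_
    exact continuous_pi fun i => by
      fin_cases i
      · exact (continuous_const.mul (continuous_const.sub continuous_snd)).mul continuous_const
      · exact (continuous_const.mul (continuous_const.sub continuous_snd)).mul continuous_const
      · exact continuous_const.mul h0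
      · exact continuous_const.mul h1
  have hPinj : Injective P := by
    rintro ⟨w, t⟩ ⟨w', t'⟩ h
    have e0 := congrArg (fun q : EuclideanSpace ℝ (Fin 4) => q 0) h
    have e1 := congrArg (fun q : EuclideanSpace ℝ (Fin 4) => q 1) h
    have e2 := congrArg (fun q : EuclideanSpace ℝ (Fin 4) => q 2) h
    have e3 := congrArg (fun q : EuclideanSpace ℝ (Fin 4) => q 3) h
    simp only [hP0, hP1, hP2, hP3] at e0 e1 e2 e3
    have ht : t = t' := by
      rcases hv with h0 | h1
      · have := mul_right_cancel₀ h0 e0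
        have := mul_left_cancel₀ hδ.ne' this
        linarith
      · have := mul_right_cancel₀ h1 e1
        have := mul_left_cancel₀ hδ.ne' this
        linarith
    have hw : w = w' := by
      ext i
      fin_cases i
      · exact mul_left_cancel₀ hρ.ne' e2
      · exact mul_left_cancel₀ hρ.ne' e3
    rw [ht, hw]
  -- the solid cylinder `K = D × [0, 1]` and its cup
  set K : Set (EuclideanSpace ℝ (Fin 2) × ℝ) :=
    closedBall (0 : EuclideanSpace ℝ (Fin 2)) 1 ×ˢ Icc (0 : ℝ) 1 with hK
  set cup : Set (EuclideanSpace ℝ (Fin 2) × ℝ) :=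
    closedBall (0 : EuclideanSpace ℝ (Fin 2)) 1 ×ˢ ({0} : Set ℝ) ∪
      sphere (0 : EuclideanSpace ℝ (Fin 2)) 1 ×ˢ Icc (0 : ℝ) 1 with hcup
  have hcupK : cup ⊆ K := by
    rintro ⟨w, t⟩ (⟨hw, ht⟩ | ⟨hw, ht⟩)
    · have ht0 : t = 0 := ht
      exact ⟨hw, by rw [ht0]; exact ⟨le_rfl, zero_le_one⟩⟩
    · exact ⟨sphere_subset_closedBall hw, ht⟩
  have hKc : IsCompact K := (isCompact_closedBall 0 1).prod isCompact_Icc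
  have hPK : ∀ p ∈ K, P p ∈ Θ.target := by
    rintro ⟨w, t⟩ ⟨hw, ht⟩
    have hw1 : ‖w‖ ≤ 1 := mem_closedBall_zero_iff.mp hw
    have e : P (w, t) = !₂[(δ * (1 - t)) * v₀, (δ * (1 - t)) * v₁, (ρ • w) 0, (ρ • w) 1] := by
      ext i; fin_cases i <;> simp [hP]
    rw [e]
    refine htarget _ ⟨by nlinarith [ht.2], by nlinarith [ht.1]⟩ _ ?_
    rw [norm_smul, Real.norm_of_nonneg hρ.le]
    nlinarith
  -- the embedding of `K`
  haveI : CompactSpace ↥K := isCompact_iff_compactSpace.mp hKc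
  set ψ : ↥K → X := fun k => Θ.symm (P k.1) with hψ
  have hψc : Continuous ψ :=
    Θ.continuousOn_symm.comp_continuous (hPc.comp continuous_subtype_val) fun k => hPK k.1 k.2
  have hψinj : Injective ψ := fun k k' h => by
    have h' : P k.1 = P k'.1 := by
      have := congrArg Θ h
      rwa [hψ, Θ.right_inv (hPK _ k.2), Θ.right_inv (hPK _ k'.2)] at this
    exact Subtype.ext (hPinj h')
  have hψemb : Topology.IsEmbedding ψ := (hψc.isClosedEmbedding hψinj).isEmbedding
  -- the cup retraction, transported
  have hsdrK := ((isStrongDeformationRetractOf_cup_box (E := EuclideanSpace ℝ (Fin 2)) one_pos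
    le_rfl).preimage_val (W := K) Subset.rfl).image_of_isEmbedding hψemb
  -- the pieces in `X`
  set C : Set X := ψ '' (Subtype.val ⁻¹' K) with hC
  set F : Set X := ψ '' (Subtype.val ⁻¹' cup) with hF
  have hCeq : C = range ψ := by
    rw [hC]
    ext x
    constructor
    · rintro ⟨k, -, rfl⟩; exact ⟨k, rfl⟩
    · rintro ⟨k, rfl⟩; exact ⟨k, k.2, rfl⟩
  have hCclosed : IsClosed C := by
    rw [hCeq]
    exact (isCompact_range hψc).isClosed
  -- points of `C`: in the source, with `Θ`-image `P`
  have hψsrc : ∀ k : ↥K, ψ k ∈ Θ.source := fun k => Θ.map_target (hPK k.1 k.2)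
  have hΘψ : ∀ k : ↥K, Θ (ψ k) = P k.1 := fun k => Θ.right_inv (hPK k.1 k.2)
  have hCH : C ⊆ H := by
    rw [hCeq]
    rintro x ⟨k, rfl⟩
    obtain ⟨⟨w, t⟩, hw, ht⟩ := k
    refine (hHΘ _ (hψsrc _)).2 ⟨δ * (1 - t), by nlinarith [ht.2], ?_, ?_⟩
    · rw [hΘψ, hP0]
    · rw [hΘψ, hP1]
  -- the bite is `C ∖ F`
  set U : Set X := {y | y ∈ Θ.source ∧ v₀ * Θ y 0 + v₁ * Θ y 1 < δ * (v₀ ^ 2 + v₁ ^ 2) ∧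
    ‖(!₂[Θ y 2, Θ y 3] : EuclideanSpace ℝ (Fin 2))‖ < ρ} with hU
  have hUopen : IsOpen U := by
    have hc2 : Continuous fun q : EuclideanSpace ℝ (Fin 4) => (!₂[q 2, q 3] : EuclideanSpace ℝ (Fin 2)) := by
      refine (PiLp.continuous_toLp 2 (fun _ : Fin 2 => ℝ)).comp ?_
      exact continuous_pi fun i => by
        fin_cases i
        · exact PiLp.continuous_apply 2 _ 2
        · exact PiLp.continuous_apply 2 _ 3
    have hlin : Continuous fun q : EuclideanSpace ℝ (Fin 4) => v₀ * q 0 + v₁ * q 1 :=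
      (continuous_const.mul (PiLp.continuous_apply 2 _ 0)).add
        (continuous_const.mul (PiLp.continuous_apply 2 _ 1))
    have : U = Θ.source ∩ Θ ⁻¹' ({q | v₀ * q 0 + v₁ * q 1 < δ * (v₀ ^ 2 + v₁ ^ 2)} ∩
        {q | ‖(!₂[q 2, q 3] : EuclideanSpace ℝ (Fin 2))‖ < ρ}) := by
      ext y
      simp only [hU, mem_inter_iff, mem_preimage, mem_setOf_eq]
    rw [this]
    exact Θ.isOpen_inter_preimage ((isOpen_lt hlin continuous_const).inter
      (isOpen_lt (continuous_norm.comp hc2) continuous_const))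
  have hHU : H ∩ U = C \ F := by
    ext y
    constructor
    · rintro ⟨hyH, hysrc, hlin, hq⟩
      obtain ⟨s, hs0, h0, h1⟩ := (hHΘ y hysrc).1 hyH
      have hsδ : s < δ := by
        have : v₀ * Θ y 0 + v₁ * Θ y 1 = s * (v₀ ^ 2 + v₁ ^ 2) := by rw [h0, h1]; ring
        rw [this] at hlin
        exact lt_of_mul_lt_mul_right hlin hnv.le
      -- the parameters of `y`
      set t : ℝ := 1 - s / δ with ht
      set w : EuclideanSpace ℝ (Fin 2) := ρ⁻¹ • !₂[Θ y 2, Θ y 3] with hw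
      have ht01 : t ∈ Icc (0 : ℝ) 1 := by
        refine ⟨?_, ?_⟩
        · rw [ht, sub_nonneg, div_le_one hδ]; exact hsδ.le
        · rw [ht, sub_le_self_iff]; positivity
      have htpos : 0 < t := by
        rw [ht, sub_pos, div_lt_one hδ]; exact hsδ
      have hw1 : ‖w‖ < 1 := by
        rw [hw, norm_smul, norm_inv, Real.norm_of_nonneg hρ.le, inv_mul_lt_iff₀ hρ, mul_one]
        exact hq
      have hk : ((w, t) : EuclideanSpace ℝ (Fin 2) × ℝ) ∈ K := ⟨mem_closedBall_zero_iff.mpr hw1.le, ht01⟩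
      have hPy : P (w, t) = Θ y := by
        have hst : δ * (1 - t) = s := by rw [ht]; field_simp; ring
        ext i
        fin_cases i
        · simp [hP, hst, h0]
        · simp [hP, hst, h1]
        · simp [hP, hw, hρ.ne']
        · simp [hP, hw, hρ.ne']
      have hyψ : ψ ⟨(w, t), hk⟩ = y := by
        rw [hψ]
        change Θ.symm (P (w, t)) = y
        rw [hPy, Θ.left_inv hysrc]
      refine ⟨?_, ?_⟩
      · rw [hCeq]; exact ⟨_, hyψ⟩
      · rintro ⟨k, hk', hky⟩
        have hkk : k = ⟨(w, t), hk⟩ := hψinj (hky.trans hyψ.symm)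
        rw [hkk] at hk'
        change ((w, t) : EuclideanSpace ℝ (Fin 2) × ℝ) ∈ cup at hk'
        rcases hk' with ⟨-, ht0⟩ | ⟨hw', -⟩
        · have : t = 0 := ht0
          linarith
        · rw [mem_sphere_zero_iff_norm] at hw'
          linarith
    · rintro ⟨hyC, hyF⟩
      rw [hCeq] at hyC
      obtain ⟨k, rfl⟩ := hyC
      obtain ⟨⟨w, t⟩, hw, ht⟩ := k
      have hw1 : ‖w‖ ≤ 1 := mem_closedBall_zero_iff.mp hw
      -- `(w, t)` is not on the cup
      have ht0 : t ≠ 0 := fun h => hyF ⟨⟨(w, t), hw, ht⟩, Or.inl ⟨hw, h⟩, rfl⟩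
      have hwn : ‖w‖ ≠ 1 := fun h => hyF ⟨⟨(w, t), hw, ht⟩,
        Or.inr ⟨mem_sphere_zero_iff_norm.mpr h, ht⟩, rfl⟩
      have htpos : 0 < t := lt_of_le_of_ne ht.1 (Ne.symm ht0)
      have hwlt : ‖w‖ < 1 := lt_of_le_of_ne hw1 hwn
      refine ⟨hCH (by rw [hCeq]; exact ⟨_, rfl⟩), hψsrc _, ?_, ?_⟩
      · rw [hΘψ, hP0, hP1]
        show v₀ * (δ * (1 - t) * v₀) + v₁ * (δ * (1 - t) * v₁) < δ * (v₀ ^ 2 + v₁ ^ 2)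
        have : v₀ * (δ * (1 - t) * v₀) + v₁ * (δ * (1 - t) * v₁) =
            (δ * (1 - t)) * (v₀ ^ 2 + v₁ ^ 2) := by ring
        rw [this]
        nlinarith [mul_pos (mul_pos hδ htpos) hnv]
      · rw [hΘψ, hP2, hP3]
        have e : (!₂[ρ * w 0, ρ * w 1] : EuclideanSpace ℝ (Fin 2)) = ρ • w := by
          ext i; fin_cases i <;> simp
        change ‖(!₂[ρ * w 0, ρ * w 1] : EuclideanSpace ℝ (Fin 2))‖ < ρ
        rw [e, norm_smul, Real.norm_of_nonneg hρ.le]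
        nlinarith
  -- conclude
  have hsdr' : IsStrongDeformationRetractOf F C := hsdrK
  exact isStrongDeformationRetractOf_diff_of_bite hH hCclosed hCH hsdr' hUopen hHU

/-- **The chart bite does not change `π₁`**: under the hypotheses of
`isStrongDeformationRetractOf_diff_chartBite`, `π₁(H ∖ U, x₀) → π₁(H, x₀)` is bijective for every
`x₀ ∈ H ∖ U` (Hatcher, Prop. 1.17) — hypothesis `hjA` of
`exists_marking_groupGKTrisectionOf_eq_stabilize(_datum)` for `A^H = H ∖ U`.
[cite: HatcherAT2002, Prop. 1.17] [cite: GayKirby2016, Def. 8] -/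
theorem bijective_inclHomOfSubset_diff_chartBite
    (Θ : OpenPartialHomeomorph X (EuclideanSpace ℝ (Fin 4))) {H : Set X} (hH : IsClosed H)
    {v₀ v₁ : ℝ} (hv : v₀ ≠ 0 ∨ v₁ ≠ 0)
    (hHΘ : ∀ y ∈ Θ.source, y ∈ H ↔ ∃ s : ℝ, 0 ≤ s ∧ Θ y 0 = s * v₀ ∧ Θ y 1 = s * v₁)
    {δ ρ : ℝ} (hδ : 0 < δ) (hρ : 0 < ρ)
    (htarget : ∀ s ∈ Icc (0 : ℝ) δ, ∀ w : EuclideanSpace ℝ (Fin 2), ‖w‖ ≤ ρ →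
      (!₂[s * v₀, s * v₁, w 0, w 1] : EuclideanSpace ℝ (Fin 4)) ∈ Θ.target)
    {x₀ : X} (hx₀ : x₀ ∈ H \ {y | y ∈ Θ.source ∧ v₀ * Θ y 0 + v₁ * Θ y 1 < δ * (v₀ ^ 2 + v₁ ^ 2) ∧
        ‖(!₂[Θ y 2, Θ y 3] : EuclideanSpace ℝ (Fin 2))‖ < ρ}) :
    Bijective (inclHomOfSubset (fun _ hx => hx.1 : H \ {y | y ∈ Θ.source ∧
        v₀ * Θ y 0 + v₁ * Θ y 1 < δ * (v₀ ^ 2 + v₁ ^ 2) ∧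
        ‖(!₂[Θ y 2, Θ y 3] : EuclideanSpace ℝ (Fin 2))‖ < ρ} ⊆ H) x₀ hx₀ hx₀.1) :=
  bijective_inclHomOfSubset_of_isStrongDeformationRetractOf
    (isStrongDeformationRetractOf_diff_chartBite Θ hH hv hHΘ hδ hρ htarget) _ hx₀

end ChartBite


/-! ### The chart cup `E` (old/new interface): simply connected, with a collar in `H ∖ U` -/

section ChartCup

variable {X : Type u} [TopologicalSpace X] [T2Space X]

/-- The parametrisation `(w, t) ↦ Θ⁻¹(δ(1 - t) v, ρ w)` of a closed half-cylinder of the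
half-plane bundle `{(q₀,q₁) = s v}` by a compact box `B̄(0, R) × [T, 1]` of `ℝ² × ℝ` inside the
chart: an embedding, with its coordinates, and the reconstruction of a point of the bundle from
its coordinates. [folklore] -/
private theorem exists_cylParam (Θ : OpenPartialHomeomorph X (EuclideanSpace ℝ (Fin 4)))
    {v₀ v₁ : ℝ} (hv : v₀ ≠ 0 ∨ v₁ ≠ 0) {δ ρ : ℝ} (R T : ℝ) (hδ : 0 < δ) (hρ : 0 < ρ)
    (htarget : ∀ p : EuclideanSpace ℝ (Fin 2) × ℝ,
      p ∈ closedBall (0 : EuclideanSpace ℝ (Fin 2)) R ×ˢ Icc T 1 →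
      (!₂[δ * (1 - p.2) * v₀, δ * (1 - p.2) * v₁, ρ * p.1 0, ρ * p.1 1] :
        EuclideanSpace ℝ (Fin 4)) ∈ Θ.target) :
    ∃ ψ : ↥(closedBall (0 : EuclideanSpace ℝ (Fin 2)) R ×ˢ Icc T 1) → X,
      Topology.IsEmbedding ψ ∧ (∀ k, ψ k ∈ Θ.source) ∧
      (∀ k, Θ (ψ k) 0 = δ * (1 - k.1.2) * v₀) ∧ (∀ k, Θ (ψ k) 1 = δ * (1 - k.1.2) * v₁) ∧
      (∀ k, ‖(!₂[Θ (ψ k) 2, Θ (ψ k) 3] : EuclideanSpace ℝ (Fin 2))‖ = ρ * ‖k.1.1‖) ∧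
      (∀ k, v₀ * Θ (ψ k) 0 + v₁ * Θ (ψ k) 1 = δ * (1 - k.1.2) * (v₀ ^ 2 + v₁ ^ 2)) ∧
      (∀ y ∈ Θ.source, ∀ s : ℝ, Θ y 0 = s * v₀ → Θ y 1 = s * v₁ →
        ∀ hk : ((ρ⁻¹ • (!₂[Θ y 2, Θ y 3] : EuclideanSpace ℝ (Fin 2)), 1 - s / δ) :
            EuclideanSpace ℝ (Fin 2) × ℝ) ∈ closedBall (0 : EuclideanSpace ℝ (Fin 2)) R ×ˢ Icc T 1,
          ψ ⟨_, hk⟩ = y) := by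
  set K : Set (EuclideanSpace ℝ (Fin 2) × ℝ) :=
    closedBall (0 : EuclideanSpace ℝ (Fin 2)) R ×ˢ Icc T 1 with hK
  set P : EuclideanSpace ℝ (Fin 2) × ℝ → EuclideanSpace ℝ (Fin 4) :=
    fun p => !₂[δ * (1 - p.2) * v₀, δ * (1 - p.2) * v₁, ρ * p.1 0, ρ * p.1 1] with hP
  have hP0 : ∀ p, P p 0 = δ * (1 - p.2) * v₀ := fun p => by simp [hP]
  have hP1 : ∀ p, P p 1 = δ * (1 - p.2) * v₁ := fun p => by simp [hP]
  have hP2 : ∀ p, P p 2 = ρ * p.1 0 := fun p => by simp [hP]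
  have hP3 : ∀ p, P p 3 = ρ * p.1 1 := fun p => by simp [hP]
  have hPc : Continuous P := by
    have h0 : Continuous fun p : EuclideanSpace ℝ (Fin 2) × ℝ => p.1 0 :=
      (PiLp.continuous_apply 2 _ 0).comp continuous_fst
    have h1 : Continuous fun p : EuclideanSpace ℝ (Fin 2) × ℝ => p.1 1 :=
      (PiLp.continuous_apply 2 _ 1).comp continuous_fst
    refine (PiLp.continuous_toLp 2 (fun _ : Fin 4 => ℝ)).comp ?_
    exact continuous_pi fun i => by
      fin_cases i
      · exact (continuous_const.mul (continuous_const.sub continuous_snd)).mul continuous_const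
      · exact (continuous_const.mul (continuous_const.sub continuous_snd)).mul continuous_const
      · exact continuous_const.mul h0
      · exact continuous_const.mul h1
  have hPinj : Injective P := by
    rintro ⟨w, t⟩ ⟨w', t'⟩ h
    have e0 := congrArg (fun q : EuclideanSpace ℝ (Fin 4) => q 0) h
    have e1 := congrArg (fun q : EuclideanSpace ℝ (Fin 4) => q 1) h
    have e2 := congrArg (fun q : EuclideanSpace ℝ (Fin 4) => q 2) h
    have e3 := congrArg (fun q : EuclideanSpace ℝ (Fin 4) => q 3) h
    simp only [hP0, hP1, hP2, hP3] at e0 e1 e2 e3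
    have ht : t = t' := by
      rcases hv with h0 | h1
      · have := mul_right_cancel₀ h0 e0
        have := mul_left_cancel₀ hδ.ne' this
        linarith
      · have := mul_right_cancel₀ h1 e1
        have := mul_left_cancel₀ hδ.ne' this
        linarith
    have hw : w = w' := by
      ext i
      fin_cases i
      · exact mul_left_cancel₀ hρ.ne' e2
      · exact mul_left_cancel₀ hρ.ne' e3
    rw [ht, hw]
  have hKc : IsCompact K := (isCompact_closedBall 0 R).prod isCompact_Icc
  haveI : CompactSpace ↥K := isCompact_iff_compactSpace.mp hKc
  set ψ : ↥K → X := fun k => Θ.symm (P k.1) with hψ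
  have hPK : ∀ k : ↥K, P k.1 ∈ Θ.target := fun k => htarget k.1 k.2
  have hψc : Continuous ψ :=
    Θ.continuousOn_symm.comp_continuous (hPc.comp continuous_subtype_val) hPK
  have hΘψ : ∀ k : ↥K, Θ (ψ k) = P k.1 := fun k => Θ.right_inv (hPK k)
  have hψinj : Injective ψ := fun k k' h => by
    have h' : P k.1 = P k'.1 := by rw [← hΘψ, ← hΘψ, h]
    exact Subtype.ext (hPinj h')
  refine ⟨ψ, (hψc.isClosedEmbedding hψinj).isEmbedding, fun k => Θ.map_target (hPK k),
    fun k => by rw [hΘψ, hP0], fun k => by rw [hΘψ, hP1], fun k => ?_, fun k => ?_,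
    fun y hy s h0 h1 hk => ?_⟩
  · rw [hΘψ, hP2, hP3]
    have e : (!₂[ρ * k.1.1 0, ρ * k.1.1 1] : EuclideanSpace ℝ (Fin 2)) = ρ • k.1.1 := by
      ext i; fin_cases i <;> simp
    rw [e, norm_smul, Real.norm_of_nonneg hρ.le]
  · rw [hΘψ, hP0, hP1]; ring
  · rw [hψ]
    change Θ.symm (P (ρ⁻¹ • !₂[Θ y 2, Θ y 3], 1 - s / δ)) = y
    have hPy : P (ρ⁻¹ • !₂[Θ y 2, Θ y 3], 1 - s / δ) = Θ y := by
      have hst : δ * (s / δ) = s := by field_simp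
      ext i
      fin_cases i
      · simp [hP, hst, h0]
      · simp [hP, hst, h1]
      · simp [hP, hρ.ne']
      · simp [hP, hρ.ne']
    rw [hPy, Θ.left_inv hy]

omit [T2Space X] in
/-- The cup of the box, read through a parametrisation as in `exists_cylParam` over a box
`B̄(0, R) × [T, 1]` with `1 ≤ R`, `T ≤ 0`, is the closed half-cylinder minus the bite. [folklore] -/
private theorem image_preimage_cup_eq (Θ : OpenPartialHomeomorph X (EuclideanSpace ℝ (Fin 4)))
    {v₀ v₁ : ℝ} (hv : v₀ ≠ 0 ∨ v₁ ≠ 0) {δ ρ R T : ℝ} (hδ : 0 < δ) (hρ : 0 < ρ) (hR : 1 ≤ R)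
    (hT : T ≤ 0) (ψ : ↥(closedBall (0 : EuclideanSpace ℝ (Fin 2)) R ×ˢ Icc T 1) → X)
    (hsrc : ∀ k, ψ k ∈ Θ.source)
    (h0 : ∀ k, Θ (ψ k) 0 = δ * (1 - k.1.2) * v₀) (h1 : ∀ k, Θ (ψ k) 1 = δ * (1 - k.1.2) * v₁)
    (hn : ∀ k, ‖(!₂[Θ (ψ k) 2, Θ (ψ k) 3] : EuclideanSpace ℝ (Fin 2))‖ = ρ * ‖k.1.1‖)
    (hlin : ∀ k, v₀ * Θ (ψ k) 0 + v₁ * Θ (ψ k) 1 = δ * (1 - k.1.2) * (v₀ ^ 2 + v₁ ^ 2))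
    (hrec : ∀ y ∈ Θ.source, ∀ s : ℝ, Θ y 0 = s * v₀ → Θ y 1 = s * v₁ →
        ∀ hk : ((ρ⁻¹ • (!₂[Θ y 2, Θ y 3] : EuclideanSpace ℝ (Fin 2)), 1 - s / δ) :
            EuclideanSpace ℝ (Fin 2) × ℝ) ∈ closedBall (0 : EuclideanSpace ℝ (Fin 2)) R ×ˢ Icc T 1,
          ψ ⟨_, hk⟩ = y) :
    ψ '' (Subtype.val ⁻¹' (closedBall (0 : EuclideanSpace ℝ (Fin 2)) 1 ×ˢ ({0} : Set ℝ) ∪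
        sphere (0 : EuclideanSpace ℝ (Fin 2)) 1 ×ˢ Icc (0 : ℝ) 1)) =
      {y | y ∈ Θ.source ∧ (∃ s : ℝ, 0 ≤ s ∧ s ≤ δ ∧ Θ y 0 = s * v₀ ∧ Θ y 1 = s * v₁) ∧
          ‖(!₂[Θ y 2, Θ y 3] : EuclideanSpace ℝ (Fin 2))‖ ≤ ρ} \
        {y | y ∈ Θ.source ∧ v₀ * Θ y 0 + v₁ * Θ y 1 < δ * (v₀ ^ 2 + v₁ ^ 2) ∧
          ‖(!₂[Θ y 2, Θ y 3] : EuclideanSpace ℝ (Fin 2))‖ < ρ} := by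
  have hnv : 0 < v₀ ^ 2 + v₁ ^ 2 := by
    rcases hv with h | h
    · have := sq_pos_of_ne_zero h; positivity
    · have := sq_pos_of_ne_zero h; positivity
  have hnorm : ∀ y : X, ‖ρ⁻¹ • (!₂[Θ y 2, Θ y 3] : EuclideanSpace ℝ (Fin 2))‖ =
      ρ⁻¹ * ‖(!₂[Θ y 2, Θ y 3] : EuclideanSpace ℝ (Fin 2))‖ := fun y => by
    rw [norm_smul, norm_inv, Real.norm_of_nonneg hρ.le]
  ext y
  constructor
  · rintro ⟨k, hk, rfl⟩
    obtain ⟨⟨w, t⟩, hwt⟩ := k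
    simp only [mem_preimage] at hk
    -- on the cup `‖w‖ ≤ 1` and `0 ≤ t ≤ 1`
    have hw1 : ‖w‖ ≤ 1 := by
      rcases hk with ⟨hw, -⟩ | ⟨hw, -⟩
      · exact mem_closedBall_zero_iff.mp hw
      · exact (mem_sphere_zero_iff_norm.mp hw).le
    have ht : 0 ≤ t ∧ t ≤ 1 := by
      rcases hk with ⟨-, ht⟩ | ⟨-, ht⟩
      · have ht0 : t = 0 := ht
        rw [ht0]; exact ⟨le_rfl, zero_le_one⟩
      · exact ht
    refine ⟨⟨hsrc _, ⟨δ * (1 - t), by nlinarith [ht.2], by nlinarith [ht.1], h0 _, h1 _⟩, ?_⟩, ?_⟩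
    · rw [hn]; change ρ * ‖w‖ ≤ ρ; nlinarith
    · rintro ⟨-, hl, hq⟩
      rw [hlin] at hl
      rw [hn] at hq
      change δ * (1 - t) * (v₀ ^ 2 + v₁ ^ 2) < δ * (v₀ ^ 2 + v₁ ^ 2) at hl
      change ρ * ‖w‖ < ρ at hq
      rcases hk with ⟨-, ht0⟩ | ⟨hw', -⟩
      · have : t = 0 := ht0
        rw [this] at hl
        linarith
      · rw [mem_sphere_zero_iff_norm] at hw'
        rw [hw'] at hq
        linarith
  · rintro ⟨⟨hy, ⟨s, hs0, hsδ, hy0, hy1⟩, hq⟩, hyU⟩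
    have hk : ((ρ⁻¹ • (!₂[Θ y 2, Θ y 3] : EuclideanSpace ℝ (Fin 2)), 1 - s / δ) :
        EuclideanSpace ℝ (Fin 2) × ℝ) ∈ closedBall (0 : EuclideanSpace ℝ (Fin 2)) R ×ˢ Icc T 1 := by
      refine ⟨?_, ?_, ?_⟩
      · rw [mem_closedBall_zero_iff, hnorm, inv_mul_le_iff₀ hρ]
        nlinarith
      · show T ≤ 1 - s / δ
        have : s / δ ≤ 1 := by rw [div_le_one hδ]; exact hsδ
        linarith
      · show 1 - s / δ ≤ 1
        rw [sub_le_self_iff]; positivity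
    refine ⟨⟨_, hk⟩, ?_, hrec y hy s hy0 hy1 hk⟩
    simp only [mem_preimage]
    by_cases hql : ‖(!₂[Θ y 2, Θ y 3] : EuclideanSpace ℝ (Fin 2))‖ < ρ
    · -- then `⟪q, v⟫ ≥ δ‖v‖²`, so `s = δ`: the bottom
      have hl : ¬ v₀ * Θ y 0 + v₁ * Θ y 1 < δ * (v₀ ^ 2 + v₁ ^ 2) := fun h => hyU ⟨hy, h, hql⟩
      have hsv : v₀ * Θ y 0 + v₁ * Θ y 1 = s * (v₀ ^ 2 + v₁ ^ 2) := by rw [hy0, hy1]; ring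
      rw [hsv, not_lt] at hl
      have hs : s = δ := le_antisymm hsδ (le_of_mul_le_mul_right hl hnv)
      left
      refine ⟨?_, ?_⟩
      · rw [mem_closedBall_zero_iff, hnorm, inv_mul_le_iff₀ hρ, mul_one]; exact hq
      · show 1 - s / δ = 0
        rw [hs, div_self hδ.ne', sub_self]
    · -- `‖q'‖ = ρ`: the side
      have hqe : ‖(!₂[Θ y 2, Θ y 3] : EuclideanSpace ℝ (Fin 2))‖ = ρ :=
        le_antisymm hq (not_lt.mp hql)
      right
      refine ⟨?_, ?_, ?_⟩
      · rw [mem_sphere_zero_iff_norm, hnorm, hqe, inv_mul_cancel₀ hρ.ne']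
      · show 0 ≤ 1 - s / δ
        rw [sub_nonneg, div_le_one hδ]; exact hsδ
      · show 1 - s / δ ≤ 1
        rw [sub_le_self_iff]; positivity

omit [T2Space X] in
/-- Rescaling the chart hypothesis: the closed half-cylinder `{s v | 0 ≤ s ≤ δ̄} × B̄²(ρ̄)` in the
target contains the `P`-image of the box `B̄(0, R) × [T, 1]` when `δ(1 - T) ≤ δ̄`, `ρ R ≤ ρ̄`.
[folklore] -/
private theorem box_mem_target (Θ : OpenPartialHomeomorph X (EuclideanSpace ℝ (Fin 4)))
    {v₀ v₁ δ ρ δb ρb R T : ℝ} (hδ : 0 < δ) (hρ : 0 < ρ) (hT : δ * (1 - T) ≤ δb) (hR : ρ * R ≤ ρb)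
    (htarget : ∀ s ∈ Icc (0 : ℝ) δb, ∀ w : EuclideanSpace ℝ (Fin 2), ‖w‖ ≤ ρb →
      (!₂[s * v₀, s * v₁, w 0, w 1] : EuclideanSpace ℝ (Fin 4)) ∈ Θ.target) :
    ∀ p : EuclideanSpace ℝ (Fin 2) × ℝ,
      p ∈ closedBall (0 : EuclideanSpace ℝ (Fin 2)) R ×ˢ Icc T 1 →
      (!₂[δ * (1 - p.2) * v₀, δ * (1 - p.2) * v₁, ρ * p.1 0, ρ * p.1 1] :
        EuclideanSpace ℝ (Fin 4)) ∈ Θ.target := by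
  rintro ⟨w, t⟩ ⟨hw, ht⟩
  have hw1 : ‖w‖ ≤ R := mem_closedBall_zero_iff.mp hw
  have e : (!₂[δ * (1 - t) * v₀, δ * (1 - t) * v₁, ρ * w 0, ρ * w 1] : EuclideanSpace ℝ (Fin 4)) =
      !₂[(δ * (1 - t)) * v₀, (δ * (1 - t)) * v₁, (ρ • w) 0, (ρ • w) 1] := by
    ext i; fin_cases i <;> simp
  rw [e]
  refine htarget _ ⟨by nlinarith [ht.2], by nlinarith [ht.1]⟩ _ ?_
  rw [norm_smul, Real.norm_of_nonneg hρ.le]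
  nlinarith

/-- **The chart cup is a disc.**  For a half-plane bundle in a chart `Θ` (as in
`isStrongDeformationRetractOf_diff_chartBite`), the closed half-cylinder minus the bite,
`E = {y ∈ Θ.source | (Θ y)₀₁ = s v, 0 ≤ s ≤ δ, ‖(Θ y)₂₃‖ ≤ ρ} ∖ U`
(`U = {⟪(Θ y)₀₁, v⟫ < δ‖v‖², ‖(Θ y)₂₃‖ < ρ}`) — the cup along which `H ∖ U` meets the
modification region — is the homeomorphic image of `D × {0} ∪ ∂D × [0, 1]`, hence **simply
connected** (so path connected with trivial `π₁`: hypotheses `hEpc`, `hE1` of the stabilisation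
step). [folklore] -/
theorem isSimplyConnected_chartCup
    (Θ : OpenPartialHomeomorph X (EuclideanSpace ℝ (Fin 4)))
    {v₀ v₁ : ℝ} (hv : v₀ ≠ 0 ∨ v₁ ≠ 0) {δ ρ : ℝ} (hδ : 0 < δ) (hρ : 0 < ρ)
    (htarget : ∀ s ∈ Icc (0 : ℝ) δ, ∀ w : EuclideanSpace ℝ (Fin 2), ‖w‖ ≤ ρ →
      (!₂[s * v₀, s * v₁, w 0, w 1] : EuclideanSpace ℝ (Fin 4)) ∈ Θ.target) :
    IsSimplyConnected
      ({y | y ∈ Θ.source ∧ (∃ s : ℝ, 0 ≤ s ∧ s ≤ δ ∧ Θ y 0 = s * v₀ ∧ Θ y 1 = s * v₁) ∧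
          ‖(!₂[Θ y 2, Θ y 3] : EuclideanSpace ℝ (Fin 2))‖ ≤ ρ} \
        {y | y ∈ Θ.source ∧ v₀ * Θ y 0 + v₁ * Θ y 1 < δ * (v₀ ^ 2 + v₁ ^ 2) ∧
          ‖(!₂[Θ y 2, Θ y 3] : EuclideanSpace ℝ (Fin 2))‖ < ρ}) := by
  obtain ⟨ψ, hψ, hsrc, h0, h1, hn, hlin, hrec⟩ := exists_cylParam Θ hv 1 0 hδ hρ
    (box_mem_target Θ hδ hρ (by linarith) (by linarith) htarget)
  rw [← image_preimage_cup_eq Θ hv hδ hρ le_rfl le_rfl ψ hsrc h0 h1 hn hlin hrec,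
    hψ.isSimplyConnected_image]
  set cup : Set (EuclideanSpace ℝ (Fin 2) × ℝ) :=
    closedBall (0 : EuclideanSpace ℝ (Fin 2)) 1 ×ˢ ({0} : Set ℝ) ∪
      sphere (0 : EuclideanSpace ℝ (Fin 2)) 1 ×ˢ Icc (0 : ℝ) 1 with hcup
  have hcupK : cup ⊆ closedBall (0 : EuclideanSpace ℝ (Fin 2)) 1 ×ˢ Icc (0 : ℝ) 1 := by
    rintro ⟨w, t⟩ (⟨hw, ht⟩ | ⟨hw, ht⟩)
    · have ht0 : t = 0 := ht
      exact ⟨hw, by rw [ht0]; exact ⟨le_rfl, zero_le_one⟩⟩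
    · exact ⟨sphere_subset_closedBall hw, ht⟩
  have hval : Subtype.val '' (Subtype.val ⁻¹' cup :
      Set ↥(closedBall (0 : EuclideanSpace ℝ (Fin 2)) 1 ×ˢ Icc (0 : ℝ) 1)) = cup := by
    rw [Subtype.image_preimage_coe, inter_eq_right.mpr hcupK]
  rw [← Topology.IsEmbedding.subtypeVal.isSimplyConnected_image, hval]
  exact isSimplyConnected_cup 1

/-- **The collar of the chart cup in `H ∖ U`.**  With `H`, `Θ`, `v`, `δ`, `ρ` as in
`isStrongDeformationRetractOf_diff_chartBite` and a slightly larger half-cylinder in the chart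
(`δ < δ'`, `ρ < ρ'`), the trace `(H ∖ U) ∩ U′` of the larger open bite
`U′ = {⟪(Θ y)₀₁, v⟫ < δ′‖v‖², ‖(Θ y)₂₃‖ < ρ′}` on `A^H = H ∖ U` is an open neighbourhood of the
cup `E` in `A^H` which strong deformation retracts onto `E` (nearest-point projection onto the
convex cylinder, `isStrongDeformationRetractOf_cup_shell`) — hypotheses `hOAH`, `hCAHe`,
`hECAH`, `hsdrA` of the stabilisation step for `A^H = H ∖ U`, `O_{A^H} = U′`.
[cite: HatcherAT2002, Ch. 0, p. 2] -/
theorem isStrongDeformationRetractOf_chartCup_shell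
    (Θ : OpenPartialHomeomorph X (EuclideanSpace ℝ (Fin 4))) {H : Set X}
    {v₀ v₁ : ℝ} (hv : v₀ ≠ 0 ∨ v₁ ≠ 0)
    (hHΘ : ∀ y ∈ Θ.source, y ∈ H ↔ ∃ s : ℝ, 0 ≤ s ∧ Θ y 0 = s * v₀ ∧ Θ y 1 = s * v₁)
    {δ ρ δ' ρ' : ℝ} (hδ : 0 < δ) (hρ : 0 < ρ) (hδδ' : δ < δ') (hρρ' : ρ < ρ')
    (htarget : ∀ s ∈ Icc (0 : ℝ) δ', ∀ w : EuclideanSpace ℝ (Fin 2), ‖w‖ ≤ ρ' →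
      (!₂[s * v₀, s * v₁, w 0, w 1] : EuclideanSpace ℝ (Fin 4)) ∈ Θ.target) :
    IsStrongDeformationRetractOf
      ({y | y ∈ Θ.source ∧ (∃ s : ℝ, 0 ≤ s ∧ s ≤ δ ∧ Θ y 0 = s * v₀ ∧ Θ y 1 = s * v₁) ∧
          ‖(!₂[Θ y 2, Θ y 3] : EuclideanSpace ℝ (Fin 2))‖ ≤ ρ} \
        {y | y ∈ Θ.source ∧ v₀ * Θ y 0 + v₁ * Θ y 1 < δ * (v₀ ^ 2 + v₁ ^ 2) ∧
          ‖(!₂[Θ y 2, Θ y 3] : EuclideanSpace ℝ (Fin 2))‖ < ρ})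
      ((H \ {y | y ∈ Θ.source ∧ v₀ * Θ y 0 + v₁ * Θ y 1 < δ * (v₀ ^ 2 + v₁ ^ 2) ∧
          ‖(!₂[Θ y 2, Θ y 3] : EuclideanSpace ℝ (Fin 2))‖ < ρ}) ∩
        {y | y ∈ Θ.source ∧ v₀ * Θ y 0 + v₁ * Θ y 1 < δ' * (v₀ ^ 2 + v₁ ^ 2) ∧
          ‖(!₂[Θ y 2, Θ y 3] : EuclideanSpace ℝ (Fin 2))‖ < ρ'}) := by
  have hnv : 0 < v₀ ^ 2 + v₁ ^ 2 := by
    rcases hv with h | h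
    · have := sq_pos_of_ne_zero h; positivity
    · have := sq_pos_of_ne_zero h; positivity
  -- the big box `B̄(0, ρ'/ρ) × [1 - δ'/δ, 1]`
  set R : ℝ := ρ' / ρ with hR
  set T : ℝ := 1 - δ' / δ with hT
  have hR1 : 1 < R := by rw [hR, one_lt_div hρ]; exact hρρ'
  have hT0 : T < 0 := by rw [hT, sub_neg, one_lt_div hδ]; exact hδδ'
  have hρR : ρ * R = ρ' := by rw [hR]; field_simp
  have hδT : δ * (1 - T) = δ' := by rw [hT]; field_simp; ring
  obtain ⟨ψ, hψ, hsrc, h0, h1, hn, hlin, hrec⟩ := exists_cylParam Θ hv R T hδ hρ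
    (box_mem_target Θ hδ hρ hδT.le hρR.le htarget)
  set Sh : Set (EuclideanSpace ℝ (Fin 2) × ℝ) :=
    {p | -(δ' / δ - 1) < p.2 ∧ p.2 ≤ 1 ∧ ‖p.1‖ < 1 + (ρ' / ρ - 1) ∧ (p.2 ≤ 0 ∨ 1 ≤ ‖p.1‖)}
    with hSh
  have hShK : Sh ⊆ closedBall (0 : EuclideanSpace ℝ (Fin 2)) R ×ˢ Icc T 1 := by
    rintro ⟨w, t⟩ ⟨ht, ht1, hw, -⟩
    refine ⟨mem_closedBall_zero_iff.mpr ?_, ?_, ht1⟩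
    · change ‖w‖ ≤ R; rw [hR]; change ‖w‖ < 1 + (ρ' / ρ - 1) at hw; linarith
    · change T ≤ t; rw [hT]; change -(δ' / δ - 1) < t at ht; linarith
  -- the shell retraction, transported
  have hsdr := ((isStrongDeformationRetractOf_cup_shell (E := EuclideanSpace ℝ (Fin 2))
    (δ' / δ - 1) (ρ' / ρ - 1)).preimage_val
    (W := closedBall (0 : EuclideanSpace ℝ (Fin 2)) R ×ˢ Icc T 1) hShK).image_of_isEmbedding hψ
  rw [image_preimage_cup_eq Θ hv hδ hρ hR1.le hT0.le ψ hsrc h0 h1 hn hlin hrec] at hsdr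
  have hnorm : ∀ y : X, ‖ρ⁻¹ • (!₂[Θ y 2, Θ y 3] : EuclideanSpace ℝ (Fin 2))‖ =
      ρ⁻¹ * ‖(!₂[Θ y 2, Θ y 3] : EuclideanSpace ℝ (Fin 2))‖ := fun y => by
    rw [norm_smul, norm_inv, Real.norm_of_nonneg hρ.le]
  -- identify the shell
  convert hsdr using 1
  ext y
  constructor
  · rintro ⟨⟨hyH, hyU⟩, hy, hl, hq⟩
    obtain ⟨s, hs0, hy0, hy1⟩ := (hHΘ y hy).1 hyH
    have hsv : v₀ * Θ y 0 + v₁ * Θ y 1 = s * (v₀ ^ 2 + v₁ ^ 2) := by rw [hy0, hy1]; ring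
    have hsδ' : s < δ' := by
      rw [hsv] at hl; exact lt_of_mul_lt_mul_right hl hnv.le
    -- the box coordinates of `y`
    have hkSh : ((ρ⁻¹ • (!₂[Θ y 2, Θ y 3] : EuclideanSpace ℝ (Fin 2)), 1 - s / δ) :
        EuclideanSpace ℝ (Fin 2) × ℝ) ∈ Sh := by
      refine ⟨?_, ?_, ?_, ?_⟩
      · show -(δ' / δ - 1) < 1 - s / δ
        have : s / δ < δ' / δ := div_lt_div_of_pos_right hsδ' hδ
        linarith
      · show 1 - s / δ ≤ 1
        rw [sub_le_self_iff]; positivity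
      · show ‖ρ⁻¹ • (!₂[Θ y 2, Θ y 3] : EuclideanSpace ℝ (Fin 2))‖ < 1 + (ρ' / ρ - 1)
        rw [hnorm, inv_mul_lt_iff₀ hρ]
        have : ρ * (1 + (ρ' / ρ - 1)) = ρ' := by field_simp; ring
        rw [this]; exact hq
      · -- `y ∉ U`: `s ≥ δ` or `‖q'‖ ≥ ρ`
        by_cases hql : ‖(!₂[Θ y 2, Θ y 3] : EuclideanSpace ℝ (Fin 2))‖ < ρ
        · have hl' : ¬ v₀ * Θ y 0 + v₁ * Θ y 1 < δ * (v₀ ^ 2 + v₁ ^ 2) :=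
            fun h => hyU ⟨hy, h, hql⟩
          rw [hsv, not_lt] at hl'
          have hsδ : δ ≤ s := le_of_mul_le_mul_right hl' hnv
          left
          show 1 - s / δ ≤ 0
          rw [sub_nonpos, one_le_div hδ]; exact hsδ
        · right
          show 1 ≤ ‖ρ⁻¹ • (!₂[Θ y 2, Θ y 3] : EuclideanSpace ℝ (Fin 2))‖
          rw [hnorm, le_inv_mul_iff₀ hρ, mul_one]
          exact not_lt.mp hql
    exact ⟨⟨_, hShK hkSh⟩, hkSh, hrec y hy s hy0 hy1 (hShK hkSh)⟩
  · rintro ⟨k, hk, rfl⟩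
    obtain ⟨⟨w, t⟩, hwt⟩ := k
    simp only [mem_preimage] at hk
    obtain ⟨ht, ht1, hw, hor⟩ := hk
    change -(δ' / δ - 1) < t at ht
    change t ≤ 1 at ht1
    change ‖w‖ < 1 + (ρ' / ρ - 1) at hw
    have hyH : ψ ⟨(w, t), hwt⟩ ∈ H :=
      (hHΘ _ (hsrc _)).2 ⟨δ * (1 - t), by nlinarith, h0 _, h1 _⟩
    refine ⟨⟨hyH, ?_⟩, hsrc _, ?_, ?_⟩
    · rintro ⟨-, hl, hq⟩
      rw [hlin] at hl
      rw [hn] at hq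
      change δ * (1 - t) * (v₀ ^ 2 + v₁ ^ 2) < δ * (v₀ ^ 2 + v₁ ^ 2) at hl
      change ρ * ‖w‖ < ρ at hq
      rcases hor with h | h
      · change t ≤ 0 at h
        nlinarith [mul_pos hδ hnv]
      · change 1 ≤ ‖w‖ at h
        nlinarith
    · rw [hlin]
      change δ * (1 - t) * (v₀ ^ 2 + v₁ ^ 2) < δ' * (v₀ ^ 2 + v₁ ^ 2)
      have : δ * (1 - t) < δ' := by
        have h' : δ * (δ' / δ) = δ' := by field_simp
        nlinarith
      exact mul_lt_mul_of_pos_right this hnv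
    · rw [hn]
      change ρ * ‖w‖ < ρ'
      have h' : ρ * (ρ' / ρ) = ρ' := by field_simp
      nlinarith

end ChartCup

/-! ### The three handlebodies of a joint chart -/

section JointChartBite

variable {X : Type u} [TopologicalSpace X]
  (Θ : OpenPartialHomeomorph X (EuclideanSpace ℝ (Fin 4))) {Si Sj Sl : Set X}

/-- In a joint chart, `S i ∩ S j = {q₀ = 0 ≤ q₁}` is the half-plane bundle of direction
`v = (0, 1)`. [cite: GayKirby2016, Def. 1 and Fig. 1] -/
theorem jointChart_inter_ij_iff
    (hSi : ∀ y ∈ Θ.source, y ∈ Si ↔ (0 ≤ Θ y 0 ∧ 0 ≤ Θ y 1))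
    (hSj : ∀ y ∈ Θ.source, y ∈ Sj ↔ (Θ y 0 ≤ 0 ∧ Θ y 0 ≤ Θ y 1)) :
    ∀ y ∈ Θ.source, y ∈ Si ∩ Sj ↔ ∃ s : ℝ, 0 ≤ s ∧ Θ y 0 = s * 0 ∧ Θ y 1 = s * 1 := by
  intro y hy
  rw [mem_inter_iff, hSi y hy, hSj y hy]
  constructor
  · rintro ⟨⟨h0, h1⟩, h0', -⟩
    exact ⟨Θ y 1, h1, by simp; linarith, by simp⟩
  · rintro ⟨s, hs, h0, h1⟩
    simp only [mul_zero, mul_one] at h0 h1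
    rw [h0, h1]
    exact ⟨⟨le_rfl, hs⟩, le_rfl, hs⟩

/-- In a joint chart, `S i ∩ S l = {q₁ = 0 ≤ q₀}` is the half-plane bundle of direction
`v = (1, 0)`. [cite: GayKirby2016, Def. 1 and Fig. 1] -/
theorem jointChart_inter_il_iff
    (hSi : ∀ y ∈ Θ.source, y ∈ Si ↔ (0 ≤ Θ y 0 ∧ 0 ≤ Θ y 1))
    (hSl : ∀ y ∈ Θ.source, y ∈ Sl ↔ (Θ y 1 ≤ 0 ∧ Θ y 1 ≤ Θ y 0)) :
    ∀ y ∈ Θ.source, y ∈ Si ∩ Sl ↔ ∃ s : ℝ, 0 ≤ s ∧ Θ y 0 = s * 1 ∧ Θ y 1 = s * 0 := by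
  intro y hy
  rw [mem_inter_iff, hSi y hy, hSl y hy]
  constructor
  · rintro ⟨⟨h0, h1⟩, h1', -⟩
    exact ⟨Θ y 0, h0, by simp, by simp; linarith⟩
  · rintro ⟨s, hs, h0, h1⟩
    simp only [mul_zero, mul_one] at h0 h1
    rw [h0, h1]
    exact ⟨⟨hs, le_rfl⟩, le_rfl, hs⟩

/-- In a joint chart, `S j ∩ S l = {q₀ = q₁ ≤ 0}` is the half-plane bundle of direction
`v = (-1, -1)`. [cite: GayKirby2016, Def. 1 and Fig. 1] -/
theorem jointChart_inter_jl_iff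
    (hSj : ∀ y ∈ Θ.source, y ∈ Sj ↔ (Θ y 0 ≤ 0 ∧ Θ y 0 ≤ Θ y 1))
    (hSl : ∀ y ∈ Θ.source, y ∈ Sl ↔ (Θ y 1 ≤ 0 ∧ Θ y 1 ≤ Θ y 0)) :
    ∀ y ∈ Θ.source, y ∈ Sj ∩ Sl ↔ ∃ s : ℝ, 0 ≤ s ∧ Θ y 0 = s * (-1) ∧ Θ y 1 = s * (-1) := by
  intro y hy
  rw [mem_inter_iff, hSj y hy, hSl y hy]
  constructor
  · rintro ⟨⟨h0, h01⟩, h1, h10⟩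
    exact ⟨-Θ y 0, by linarith, by ring, by linarith⟩
  · rintro ⟨s, hs, h0, h1⟩
    rw [h0, h1]
    exact ⟨⟨by linarith, le_rfl⟩, by linarith, le_rfl⟩

/-- **`hjA` for `H = S i ∩ S j = {q₀ = 0 ≤ q₁}`**: biting the open half-cylinder
`{q₀ = 0, 0 ≤ q₁ < δ, ‖(q₂, q₃)‖ < ρ}` (inside the chart, with the closed half-cylinder in the
target) out of the handlebody `S i ∩ S j` of a joint chart does not change `π₁`: for `S i`, `S j`
closed and `x₀ ∈ (S i ∩ S j) ∖ U`, `π₁((S i ∩ S j) ∖ U, x₀) → π₁(S i ∩ S j, x₀)` is bijective, where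
`U = {y ∈ Θ.source | Θ y 1 < δ, ‖(Θ y 2, Θ y 3)‖ < ρ}`.
[cite: HatcherAT2002, Prop. 0.16 and Prop. 1.17] [cite: GayKirby2016, Def. 8] -/
theorem bijective_inclHomOfSubset_diff_jointChartBite_ij [T2Space X] (hSic : IsClosed Si) (hSjc : IsClosed Sj)
    (hSi : ∀ y ∈ Θ.source, y ∈ Si ↔ (0 ≤ Θ y 0 ∧ 0 ≤ Θ y 1))
    (hSj : ∀ y ∈ Θ.source, y ∈ Sj ↔ (Θ y 0 ≤ 0 ∧ Θ y 0 ≤ Θ y 1))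
    {δ ρ : ℝ} (hδ : 0 < δ) (hρ : 0 < ρ)
    (htarget : ∀ s ∈ Icc (0 : ℝ) δ, ∀ w : EuclideanSpace ℝ (Fin 2), ‖w‖ ≤ ρ →
      (!₂[0, s, w 0, w 1] : EuclideanSpace ℝ (Fin 4)) ∈ Θ.target)
    {x₀ : X} (hx₀ : x₀ ∈ (Si ∩ Sj) \ {y | y ∈ Θ.source ∧ Θ y 1 < δ ∧
        ‖(!₂[Θ y 2, Θ y 3] : EuclideanSpace ℝ (Fin 2))‖ < ρ}) :
    IsStrongDeformationRetractOf ((Si ∩ Sj) \ {y | y ∈ Θ.source ∧ Θ y 1 < δ ∧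
        ‖(!₂[Θ y 2, Θ y 3] : EuclideanSpace ℝ (Fin 2))‖ < ρ}) (Si ∩ Sj) ∧
      Bijective (inclHomOfSubset (fun _ hx => hx.1 : (Si ∩ Sj) \ {y | y ∈ Θ.source ∧ Θ y 1 < δ ∧
        ‖(!₂[Θ y 2, Θ y 3] : EuclideanSpace ℝ (Fin 2))‖ < ρ} ⊆ Si ∩ Sj) x₀ hx₀ hx₀.1) := by
  have hU : {y | y ∈ Θ.source ∧ Θ y 1 < δ ∧ ‖(!₂[Θ y 2, Θ y 3] : EuclideanSpace ℝ (Fin 2))‖ < ρ} =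
      {y | y ∈ Θ.source ∧ (0 : ℝ) * Θ y 0 + 1 * Θ y 1 < δ * ((0 : ℝ) ^ 2 + 1 ^ 2) ∧
        ‖(!₂[Θ y 2, Θ y 3] : EuclideanSpace ℝ (Fin 2))‖ < ρ} := by
    ext y; simp
  have htarget' : ∀ s ∈ Icc (0 : ℝ) δ, ∀ w : EuclideanSpace ℝ (Fin 2), ‖w‖ ≤ ρ →
      (!₂[s * 0, s * 1, w 0, w 1] : EuclideanSpace ℝ (Fin 4)) ∈ Θ.target := fun s hs w hw => by
    simpa using htarget s hs w hw
  have h := isStrongDeformationRetractOf_diff_chartBite Θ (hSic.inter hSjc) (Or.inr one_ne_zero)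
    (jointChart_inter_ij_iff Θ hSi hSj) hδ hρ htarget'
  rw [← hU] at h
  exact ⟨h, bijective_inclHomOfSubset_of_isStrongDeformationRetractOf h _ hx₀⟩

/-- **`hjA` for `H = S i ∩ S l = {q₁ = 0 ≤ q₀}`**, bite `U = {y ∈ Θ.source | Θ y 0 < δ,
‖(Θ y 2, Θ y 3)‖ < ρ}`. [cite: HatcherAT2002, Prop. 0.16 and Prop. 1.17] [cite: GayKirby2016, Def. 8] -/
theorem bijective_inclHomOfSubset_diff_jointChartBite_il [T2Space X] (hSic : IsClosed Si) (hSlc : IsClosed Sl)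
    (hSi : ∀ y ∈ Θ.source, y ∈ Si ↔ (0 ≤ Θ y 0 ∧ 0 ≤ Θ y 1))
    (hSl : ∀ y ∈ Θ.source, y ∈ Sl ↔ (Θ y 1 ≤ 0 ∧ Θ y 1 ≤ Θ y 0))
    {δ ρ : ℝ} (hδ : 0 < δ) (hρ : 0 < ρ)
    (htarget : ∀ s ∈ Icc (0 : ℝ) δ, ∀ w : EuclideanSpace ℝ (Fin 2), ‖w‖ ≤ ρ →
      (!₂[s, 0, w 0, w 1] : EuclideanSpace ℝ (Fin 4)) ∈ Θ.target)
    {x₀ : X} (hx₀ : x₀ ∈ (Si ∩ Sl) \ {y | y ∈ Θ.source ∧ Θ y 0 < δ ∧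
        ‖(!₂[Θ y 2, Θ y 3] : EuclideanSpace ℝ (Fin 2))‖ < ρ}) :
    IsStrongDeformationRetractOf ((Si ∩ Sl) \ {y | y ∈ Θ.source ∧ Θ y 0 < δ ∧
        ‖(!₂[Θ y 2, Θ y 3] : EuclideanSpace ℝ (Fin 2))‖ < ρ}) (Si ∩ Sl) ∧
      Bijective (inclHomOfSubset (fun _ hx => hx.1 : (Si ∩ Sl) \ {y | y ∈ Θ.source ∧ Θ y 0 < δ ∧
        ‖(!₂[Θ y 2, Θ y 3] : EuclideanSpace ℝ (Fin 2))‖ < ρ} ⊆ Si ∩ Sl) x₀ hx₀ hx₀.1) := by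
  have hU : {y | y ∈ Θ.source ∧ Θ y 0 < δ ∧ ‖(!₂[Θ y 2, Θ y 3] : EuclideanSpace ℝ (Fin 2))‖ < ρ} =
      {y | y ∈ Θ.source ∧ (1 : ℝ) * Θ y 0 + 0 * Θ y 1 < δ * ((1 : ℝ) ^ 2 + 0 ^ 2) ∧
        ‖(!₂[Θ y 2, Θ y 3] : EuclideanSpace ℝ (Fin 2))‖ < ρ} := by
    ext y; simp
  have htarget' : ∀ s ∈ Icc (0 : ℝ) δ, ∀ w : EuclideanSpace ℝ (Fin 2), ‖w‖ ≤ ρ →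
      (!₂[s * 1, s * 0, w 0, w 1] : EuclideanSpace ℝ (Fin 4)) ∈ Θ.target := fun s hs w hw => by
    simpa using htarget s hs w hw
  have h := isStrongDeformationRetractOf_diff_chartBite Θ (hSic.inter hSlc) (Or.inl one_ne_zero)
    (jointChart_inter_il_iff Θ hSi hSl) hδ hρ htarget'
  rw [← hU] at h
  exact ⟨h, bijective_inclHomOfSubset_of_isStrongDeformationRetractOf h _ hx₀⟩

/-- **`hjA` for `H = S j ∩ S l = {q₀ = q₁ ≤ 0}`** (the diagonal half-plane), bite
`U = {y ∈ Θ.source | -(Θ y 0 + Θ y 1) < 2δ, ‖(Θ y 2, Θ y 3)‖ < ρ}` (depth `δ` along the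
direction `(-1, -1)`). [cite: HatcherAT2002, Prop. 0.16 and Prop. 1.17] [cite: GayKirby2016, Def. 8] -/
theorem bijective_inclHomOfSubset_diff_jointChartBite_jl [T2Space X] (hSjc : IsClosed Sj) (hSlc : IsClosed Sl)
    (hSj : ∀ y ∈ Θ.source, y ∈ Sj ↔ (Θ y 0 ≤ 0 ∧ Θ y 0 ≤ Θ y 1))
    (hSl : ∀ y ∈ Θ.source, y ∈ Sl ↔ (Θ y 1 ≤ 0 ∧ Θ y 1 ≤ Θ y 0))
    {δ ρ : ℝ} (hδ : 0 < δ) (hρ : 0 < ρ)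
    (htarget : ∀ s ∈ Icc (0 : ℝ) δ, ∀ w : EuclideanSpace ℝ (Fin 2), ‖w‖ ≤ ρ →
      (!₂[-s, -s, w 0, w 1] : EuclideanSpace ℝ (Fin 4)) ∈ Θ.target)
    {x₀ : X} (hx₀ : x₀ ∈ (Sj ∩ Sl) \ {y | y ∈ Θ.source ∧ -(Θ y 0 + Θ y 1) < 2 * δ ∧
        ‖(!₂[Θ y 2, Θ y 3] : EuclideanSpace ℝ (Fin 2))‖ < ρ}) :
    IsStrongDeformationRetractOf ((Sj ∩ Sl) \ {y | y ∈ Θ.source ∧ -(Θ y 0 + Θ y 1) < 2 * δ ∧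
        ‖(!₂[Θ y 2, Θ y 3] : EuclideanSpace ℝ (Fin 2))‖ < ρ}) (Sj ∩ Sl) ∧
      Bijective (inclHomOfSubset (fun _ hx => hx.1 : (Sj ∩ Sl) \ {y | y ∈ Θ.source ∧
        -(Θ y 0 + Θ y 1) < 2 * δ ∧
        ‖(!₂[Θ y 2, Θ y 3] : EuclideanSpace ℝ (Fin 2))‖ < ρ} ⊆ Sj ∩ Sl) x₀ hx₀ hx₀.1) := by
  have hU : {y | y ∈ Θ.source ∧ -(Θ y 0 + Θ y 1) < 2 * δ ∧
        ‖(!₂[Θ y 2, Θ y 3] : EuclideanSpace ℝ (Fin 2))‖ < ρ} =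
      {y | y ∈ Θ.source ∧ (-1 : ℝ) * Θ y 0 + (-1) * Θ y 1 < δ * ((-1 : ℝ) ^ 2 + (-1) ^ 2) ∧
        ‖(!₂[Θ y 2, Θ y 3] : EuclideanSpace ℝ (Fin 2))‖ < ρ} := by
    ext y
    simp only [mem_setOf_eq]
    constructor
    · rintro ⟨h1, h2, h3⟩; exact ⟨h1, by linarith, h3⟩
    · rintro ⟨h1, h2, h3⟩; exact ⟨h1, by linarith, h3⟩
  have htarget' : ∀ s ∈ Icc (0 : ℝ) δ, ∀ w : EuclideanSpace ℝ (Fin 2), ‖w‖ ≤ ρ →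
      (!₂[s * (-1), s * (-1), w 0, w 1] : EuclideanSpace ℝ (Fin 4)) ∈ Θ.target :=
    fun s hs w hw => by simpa using htarget s hs w hw
  have h := isStrongDeformationRetractOf_diff_chartBite Θ (hSjc.inter hSlc)
    (Or.inl (neg_ne_zero.mpr one_ne_zero)) (jointChart_inter_jl_iff Θ hSj hSl) hδ hρ htarget'
  rw [← hU] at h
  exact ⟨h, bijective_inclHomOfSubset_of_isStrongDeformationRetractOf h _ hx₀⟩

end JointChartBite

end Literature.Topology.FourManifolds
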